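import Summits.CriticalPhenomena.Ising3DConformalLimit.Theorems.EnergyNotSigmaSquaredMoebiusLimitExistsDefs
import Literature.Probability.LatticeModels.ConformalCovariance
import Literature.Probability.LatticeModels.HighDimPointwiseTriviality
import Literature.Probability.LatticeModels.CriticalWickIff
import Mathlib.Geometry.Euclidean.Inversion.Basic
import HarnessLib

/-!
# The open stubs of line `only-interaction-breaks-moebius` NEED the lattice provenance
(crux `MoebiusLimitExists`, item stmt-CriticalPhenomena-1344; refuter `drefute`)

Load-bearing analysis of the hypothesis `IsClusterPoint` — the only lattice input of STUBS 3, 5, 6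
of the checked skeleton `Cruxes/MoebiusLimitExists/Lines/only-interaction-breaks-moebius.lean`:
dropping it makes each stub FALSE, by explicit families (built inside the proofs, no definitions).

* `exists_regular_interacting_pair`: two REGULAR families (normalised, continuous off the
  diagonals, translation invariant) with the pure-power pair function `‖x₀−x₁‖⁻²` (`Δ = 1`) and
  CONSTANT four-point functions `4`, `5` on `NonCoincident`: the first is interacting (`U₄ ≥ 1` at
  `(0,e₀,2e₀,3e₀)`) and NOT inversion covariant (`4 ≠ 576·4` at `(e₀,2e₀,3e₀,4e₀)`), and they differ
  at order 4. Hence `stub5_false_without_clusterPoint`, `stub6_false_without_clusterPoints`: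
  regularity + pure-power pair function + interaction carry NO inversion or uniqueness content.
* `stub3_false_without_clusterPoint`: the Wick family `W_1` with its order-6 function zeroed has
  the pure-power pair function and `U₄ ≡ 0` but is not `W_1` at order 6 (`pairingSum_pos`): the
  Wick identities at orders `≥ 6` are lattice content (Aizenman's inequality along the mesh
  sequence), not consequences of `S₂` and `U₄ ≡ 0`.

References: Aizenman, Comm. Math. Phys. 86 (1982), Prop. 12.1; Di Francesco–Mathieu–Sénéchal 1997
§4.3.1.
-/

noncomputable section

open Filter Topology Set Function EuclideanGeometry
open Literature.Probability.LatticeModels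
open Summit.CriticalPhenomena.Ising3DConformalLimit.MoebiusLimitExistsOnlyInteraction

namespace Summit.CriticalPhenomena.Ising3DConformalLimit.StubsNeedLattice

/-- `‖t e₀‖ = |t|`. [folklore] -/
theorem norm_smul_single (t : ℝ) : ‖t • (EuclideanSpace.single (0 : Fin 3) (1 : ℝ))‖ = |t| := by
  rw [norm_smul, Real.norm_eq_abs]
  simp

/-- `t ↦ t e₀` is injective. [folklore] -/
theorem smul_single_injective :
    Injective fun t : ℝ => t • (EuclideanSpace.single (0 : Fin 3) (1 : ℝ)) := by
  refine smul_left_injective ℝ ?_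
  intro h
  have := congrArg (fun v : EuclideanSpace ℝ (Fin 3) => ‖v‖) h
  simp at this

/-- Axis configurations `i ↦ c i • e₀` with `c` injective are non-coincident. [folklore] -/
theorem axis_mem_nonCoincident {n : ℕ} {c : Fin n → ℝ} (hc : Injective c) :
    (fun i => c i • (EuclideanSpace.single (0 : Fin 3) (1 : ℝ))) ∈ NonCoincident 3 n := by
  rw [mem_nonCoincident]
  intro i j hij
  exact hc (smul_single_injective hij)

/-- **Two regular families killing STUBS 5 and 6 without `IsClusterPoint`.** There are regular
families `S₁, S₂` (normalised, continuous off the diagonals, translation invariant) with pair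
function `‖x₀−x₁‖⁻²` such that `S₁` is interacting and not inversion covariant with `Δ = 1`, and
`S₁ ≠ S₂` at some non-coincident quadruple. (`Sᵦ n x = ‖x₀−x₁‖⁻²` at `n = 2`, `= b` at `n = 4`,
`= 0` otherwise, on `NonCoincident`; `b = 4, 5`.) [folklore] -/
theorem exists_regular_interacting_pair :
    ∃ S₁ S₂ : CorrFamily 3,
      Summit.CriticalPhenomena.Ising3DConformalLimit.MoebiusLimitExistsOnlyInteraction.IsRegular S₁ ∧
      Summit.CriticalPhenomena.Ising3DConformalLimit.MoebiusLimitExistsOnlyInteraction.IsRegular S₂ ∧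
      (∀ x ∈ NonCoincident 3 2, S₁ 2 x = ‖x 0 - x 1‖ ^ (-(2 * (1:ℝ)))) ∧
      (∀ x ∈ NonCoincident 3 2, S₂ 2 x = ‖x 0 - x 1‖ ^ (-(2 * (1:ℝ)))) ∧
      HasNontrivialU4 S₁ ∧ ¬ IsInversionCovariant 1 S₁ ∧
      ∃ z ∈ NonCoincident 3 4, S₁ 4 z ≠ S₂ 4 z := by
  classical
  -- the families
  let F : ℝ → CorrFamily 3 := fun b n x =>
    if x ∈ NonCoincident 3 n then
      (if h : n = 2 then ‖x ⟨0, by omega⟩ - x ⟨1, by omega⟩‖ ^ (-(2 * (1:ℝ)))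
        else if n = 4 then b else 0)
    else 0
  have F_two : ∀ b, ∀ x ∈ NonCoincident 3 2, F b 2 x = ‖x 0 - x 1‖ ^ (-(2 * (1:ℝ))) := by
    intro b x hx
    simp only [F, if_pos hx]
    rfl
  have F_four : ∀ b, ∀ x ∈ NonCoincident 3 4, F b 4 x = b := by
    intro b x hx
    simp only [F, if_pos hx]
    simp
  have F_not_mem : ∀ b n (x : Fin n → EuclideanSpace ℝ (Fin 3)), x ∉ NonCoincident 3 n →
      F b n x = 0 := by
    intro b n x hx
    simp only [F, if_neg hx]
  have F_other : ∀ b n (x : Fin n → EuclideanSpace ℝ (Fin 3)), n ≠ 2 → n ≠ 4 →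
      x ∈ NonCoincident 3 n → F b n x = 0 := by
    intro b n x h2 h4 hx
    simp only [F, if_pos hx, dif_neg h2, if_neg h4]
  -- regularity
  have F_reg : ∀ b,
      Summit.CriticalPhenomena.Ising3DConformalLimit.MoebiusLimitExistsOnlyInteraction.IsRegular (F b) := by
    intro b
    refine ⟨fun n x hx => F_not_mem b n x hx, fun n => ?_, fun n v x => ?_⟩
    · by_cases h2 : n = 2
      · subst h2
        have hcont : ContinuousOn (fun y : Fin 2 → EuclideanSpace ℝ (Fin 3) =>
            ‖y 0 - y 1‖ ^ (-(2 * (1:ℝ)))) (NonCoincident 3 2) := by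
          refine ContinuousOn.rpow_const ?_ fun y hy => Or.inl ?_
          · exact (((continuous_apply 0).sub (continuous_apply 1)).norm).continuousOn
          · refine norm_ne_zero_iff.2 (sub_ne_zero.2 fun h01 => ?_)
            exact absurd ((mem_nonCoincident y).1 hy h01) (by decide)
        exact hcont.congr fun y hy => F_two b y hy
      · by_cases h4 : n = 4
        · subst h4
          exact (continuousOn_const (c := b)).congr fun y hy => F_four b y hy
        · exact (continuousOn_const (c := (0:ℝ))).congr fun y hy => F_other b n y h2 h4 hy
    · have hiff : (fun i => x i + v) ∈ NonCoincident 3 n ↔ x ∈ NonCoincident 3 n := by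
        rw [mem_nonCoincident, mem_nonCoincident]
        exact (add_left_injective v).of_comp_iff x
      by_cases hx : x ∈ NonCoincident 3 n
      · have hxv := hiff.2 hx
        by_cases h2 : n = 2
        · subst h2
          rw [F_two b _ hxv, F_two b _ hx, add_sub_add_right_eq_sub]
        · by_cases h4 : n = 4
          · subst h4
            rw [F_four b _ hxv, F_four b _ hx]
          · rw [F_other b n _ h2 h4 hxv, F_other b n _ h2 h4 hx]
      · rw [F_not_mem b n _ hx, F_not_mem b n _ (mt hiff.1 hx)]
  -- the pair function on axis pairs at distance ≥ 1 lies in [0,1]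
  set e : EuclideanSpace ℝ (Fin 3) := EuclideanSpace.single 0 1 with he
  have pair_le : ∀ b (s t : ℝ), 1 ≤ |s - t| →
      0 ≤ F b 2 ![s • e, t • e] ∧ F b 2 ![s • e, t • e] ≤ 1 := by
    intro b s t hst
    have hne : s • e ≠ t • e := fun h => by
      have := smul_single_injective h
      rw [this, sub_self, abs_zero] at hst
      exact absurd hst (by norm_num)
    rw [F_two b _ (pair_mem_nonCoincident hne)]
    simp only [Matrix.cons_val_zero, Matrix.cons_val_one]
    rw [← sub_smul, he, norm_smul_single]
    exact ⟨Real.rpow_nonneg (abs_nonneg _) _,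
      Real.rpow_le_one_of_one_le_of_nonpos hst (by norm_num)⟩
  -- the two axis quadruples
  have hq : Injective (![0, 1, 2, 3] : Fin 4 → ℝ) := by
    intro i j hij; fin_cases i <;> fin_cases j <;> first | rfl | (exfalso; norm_num at hij)
  have hq' : Injective (![1, 2, 3, 4] : Fin 4 → ℝ) := by
    intro i j hij; fin_cases i <;> fin_cases j <;> first | rfl | (exfalso; norm_num at hij)
  have quad_mem := axis_mem_nonCoincident hq
  have quad'_mem := axis_mem_nonCoincident hq'
  refine ⟨F 4, F 5, F_reg 4, F_reg 5, F_two 4, F_two 5, ?_, ?_, ?_⟩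
  · -- interacting: `U₄(0,e,2e,3e) ≥ 4 - 3`
    refine ⟨_, quad_mem, ?_⟩
    unfold limitConnectedFour
    rw [F_four 4 _ quad_mem]
    simp only [Matrix.cons_val_zero, Matrix.cons_val_one, Matrix.cons_val]
    have h01 := pair_le 4 0 1 (by norm_num)
    have h23 := pair_le 4 2 3 (by norm_num)
    have h02 := pair_le 4 0 2 (by norm_num)
    have h13 := pair_le 4 1 3 (by norm_num)
    have h03 := pair_le 4 0 3 (by norm_num)
    have h12 := pair_le 4 1 2 (by norm_num)
    nlinarith [mul_le_one₀ h01.2 h23.1 h23.2, mul_le_one₀ h02.2 h13.1 h13.2,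
      mul_le_one₀ h03.2 h12.1 h12.2, mul_nonneg h01.1 h23.1, mul_nonneg h02.1 h13.1,
      mul_nonneg h03.1 h12.1]
  · -- not inversion covariant at `(e,2e,3e,4e)`: `4 = 576 · 4` is false
    intro hinv
    have hne : ∀ i, (fun i => (![1, 2, 3, 4] : Fin 4 → ℝ) i • e) i ≠ 0 := by
      intro i
      fin_cases i <;> simp [he]
    have h4 := hinv 4 _ hne
    have hmem : (fun i => inversion (0 : EuclideanSpace ℝ (Fin 3)) 1
        ((fun i => (![1, 2, 3, 4] : Fin 4 → ℝ) i • e) i)) ∈ NonCoincident 3 4 := by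
      rw [mem_nonCoincident]
      exact fun i j hij => (mem_nonCoincident _).1 quad'_mem (inversion_injective _ one_ne_zero hij)
    rw [F_four 4 _ hmem, F_four 4 _ quad'_mem, Fin.prod_univ_four] at h4
    simp only [Matrix.cons_val_zero, Matrix.cons_val_one, Matrix.cons_val, he, norm_smul_single,
      mul_one] at h4
    norm_num [Real.rpow_two] at h4
  · exact ⟨_, quad_mem, by rw [F_four 4 _ quad_mem, F_four 5 _ quad_mem]; norm_num⟩

/-- **STUB 5 is false without `IsClusterPoint`**: regularity + pure-power pair function +
interaction carry NO inversion content. Any proof of `stub_interactingInversion` must use the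
lattice provenance of `S`. [folklore] -/
theorem stub5_false_without_clusterPoint :
    ¬ ∀ (Δ : ℝ) (S : CorrFamily 3),
      Summit.CriticalPhenomena.Ising3DConformalLimit.MoebiusLimitExistsOnlyInteraction.IsRegular S →
      (∀ x ∈ NonCoincident 3 2, S 2 x = ‖x 0 - x 1‖ ^ (-(2 * Δ))) →
      HasNontrivialU4 S → IsInversionCovariant Δ S := by
  intro h
  obtain ⟨S₁, S₂, hreg₁, -, h2₁, -, hU, hnot, -⟩ := exists_regular_interacting_pair
  exact hnot (h 1 S₁ hreg₁ h2₁ hU)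

/-- **STUB 6 is false without the `IsClusterPoint` hypotheses**: two regular families with the same
pure-power pair function, one interacting, differing at order 4. Any proof of
`stub_interactingUnique` must use the lattice provenance of both families. [folklore] -/
theorem stub6_false_without_clusterPoints :
    ¬ ∀ (Δ : ℝ) (S₁ S₂ : CorrFamily 3),
      Summit.CriticalPhenomena.Ising3DConformalLimit.MoebiusLimitExistsOnlyInteraction.IsRegular S₁ →
      Summit.CriticalPhenomena.Ising3DConformalLimit.MoebiusLimitExistsOnlyInteraction.IsRegular S₂ →
      (∀ x ∈ NonCoincident 3 2, S₁ 2 x = ‖x 0 - x 1‖ ^ (-(2 * Δ))) →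
      (∀ x ∈ NonCoincident 3 2, S₂ 2 x = ‖x 0 - x 1‖ ^ (-(2 * Δ))) →
      HasNontrivialU4 S₁ → ∀ n, (NonCoincident 3 n).EqOn (S₁ n) (S₂ n) := by
  intro h
  obtain ⟨S₁, S₂, hreg₁, hreg₂, h2₁, h2₂, hU, -, z, hz, hne⟩ := exists_regular_interacting_pair
  exact hne (h 1 S₁ S₂ hreg₁ hreg₂ h2₁ h2₂ hU 4 hz)

/-! ### STUB 3 without `IsClusterPoint` -/

/-- The Gaussian pairing functional of a kernel positive on distinct entries is positive. [folklore] -/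
theorem pairingSum_pos {α : Type*} (K : α → α → ℝ) (m : ℕ) (x : Fin (2 * m) → α)
    (hK : ∀ i j, i ≠ j → 0 < K (x i) (x j)) : 0 < pairingSum K m x := by
  unfold pairingSum
  refine mul_pos (by positivity) (Finset.sum_pos (fun τ _ => Finset.prod_pos fun j _ => hK _ _ ?_)
    Finset.univ_nonempty)
  intro h
  have := (pairIdx m).injective (τ.injective h)
  simp at this

/-- **STUB 3 is false without `IsClusterPoint`** (witness: `W_1` with `S₆ := 0`; it has the
pure-power pair function and `U₄ ≡ 0`, but is not `W_1` at order 6 — `W_1` is positive at six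
axis points). The Wick identities at orders `≥ 6` are lattice content. [cite: AizenmanCMP1982, Prop. 12.1] -/
theorem stub3_false_without_clusterPoint :
    ¬ ∀ (Δ : ℝ) (S : CorrFamily 3),
      (∀ x ∈ NonCoincident 3 2, S 2 x = ‖x 0 - x 1‖ ^ (-(2 * Δ))) →
      (∀ z ∈ NonCoincident 3 4, limitConnectedFour S z = 0) →
      ∀ n, ∀ x ∈ NonCoincident 3 n, S n x = wickPower Δ n x := by
  classical
  intro h
  let W6 : CorrFamily 3 := fun n x => if n = 6 then 0 else wickPower 1 n x
  have h2 : ∀ x ∈ NonCoincident 3 2, W6 2 x = ‖x 0 - x 1‖ ^ (-(2 * (1:ℝ))) := by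
    intro x hx
    simp only [W6, if_neg (show (2:ℕ) ≠ 6 by decide)]
    exact wickPower_two hx
  have hpair : ∀ {p q : EuclideanSpace ℝ (Fin 3)}, p ≠ q → W6 2 ![p, q] = powerKernel 1 p q := by
    intro p q hpq
    rw [h2 _ (pair_mem_nonCoincident hpq)]
    rfl
  have hU : ∀ z ∈ NonCoincident 3 4, limitConnectedFour W6 z = 0 := by
    intro z hz
    have hinj : Injective z := hz
    unfold limitConnectedFour
    have h4 : W6 4 z = pairingSum (powerKernel 1) 2 z := by
      simp only [W6, if_neg (show (4:ℕ) ≠ 6 by decide)]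
      exact wickPower_of_mem_even (m := 2) hz
    rw [h4, pairingSum_two _ (powerKernel_comm 1),
      hpair (hinj.ne (by decide : (0 : Fin 4) ≠ 1)), hpair (hinj.ne (by decide : (2 : Fin 4) ≠ 3)),
      hpair (hinj.ne (by decide : (0 : Fin 4) ≠ 2)), hpair (hinj.ne (by decide : (1 : Fin 4) ≠ 3)),
      hpair (hinj.ne (by decide : (0 : Fin 4) ≠ 3)), hpair (hinj.ne (by decide : (1 : Fin 4) ≠ 2))]
    ring
  -- six axis points
  have hc : Injective (fun i : Fin (2 * 3) => ((i : ℕ) : ℝ)) := fun i j hij =>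
    Fin.ext (Nat.cast_injective (R := ℝ) hij)
  have hexa_mem := axis_mem_nonCoincident hc
  have hpos : 0 < wickPower 1 (2 * 3)
      (fun i : Fin (2 * 3) => ((i : ℕ) : ℝ) • (EuclideanSpace.single (0 : Fin 3) (1 : ℝ))) := by
    rw [wickPower_of_mem_even hexa_mem]
    refine pairingSum_pos _ 3 _ fun i j hij => ?_
    unfold powerKernel
    exact Real.rpow_pos_of_pos (norm_pos_iff.2 (sub_ne_zero.2 fun h' => hij (hexa_mem h'))) _
  have h6 := h 1 W6 h2 hU (2 * 3) _ hexa_mem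
  have hz : W6 (2 * 3) (fun i : Fin (2 * 3) => ((i : ℕ) : ℝ) • (EuclideanSpace.single (0 : Fin 3) (1 : ℝ))) = 0 := by
    simp [W6]
  rw [hz] at h6
  exact absurd h6 (ne_of_lt hpos)

end Summit.CriticalPhenomena.Ising3DConformalLimit.StubsNeedLattice

end
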